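import Summits.PneNP.PneNP.Theorems.BISOrderDimensionAssembly
import Summits.PneNP.PneNP.Theorems.PhaseTwinsNoFBPPApproxAboveUniquenessConjectureNode
import Summits.PneNP.PneNP.Theorems.PhaseTwinsNoFBPPApproxAboveUniquenessLever
import Literature.Computability.Complexity.BISDownsetsProofs
import Literature.Computability.Complexity.BISDownsetsTheorem5Proofs
import Literature.Computability.Complexity.FPRASTransfer
import Literature.Computability.Complexity.BISHardnessBoundedDegree
import Literature.Computability.Complexity.ParityClosure
import Literature.Computability.Complexity.CountingHierarchyPH

/-!
# DECOMPOSITION AUDIT — kernel-checked companion of `Cruxes/IdealsNoFPRAS/STRATEGY-CENSUS.md`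

Crux `stmt-PneNP-2091` = `X := Summit.PneNP.PneNP.Theses.BISOrderDimension.IdealsNoFPRAS`
("no FPRAS for #IDEALS = #DOWNSETS", the #BIS conjecture of Dyer–Goldberg–Greenhill–Jerrum 2003 in
Dedekind's clothing), route BISOrderDimension; `S := _root_.PneNP`. The route re-audit (BC2, human ruling
2026-08-16) bins `X` RESTATED (≥ the summit) and asks for a typed decomposition `X₁ ∧ … ∧ X_k → X` with
(a) k ≥ 2 load-bearing pieces, (b) a PROVED assembly (trivial joins allowed), (c) no piece giving `S` or
`X` on its own, (d) a plan for every open piece — or a census of every attempt with the violated clause.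
This file holds what a kernel can check of that census (crux-strategist `cstrat-stmt-PneNP-2091-r1`,
gen 1, 2026-08-17). 0 sorries; EVIDENCE, not a landing; every ingredient is a PROVED theorem of the tree.

## §0 Calibration (new): `#IDEALS ∈ #P`, hence `X → NP ⊄ BPP → S`
`downsetCount_mem_SharpP` (the ideal-indicator relation of `BISOrderDimensionIdealVerifier` summed over
`{0,1}^{n_x}`), `npNotSubsetBPP_of_X` (with the PhaseTwins lever `NP ⊆ BPP → every #P function has an
FPRAS`), `X ↔ ¬HasFPRAS bisCount` (DGGJ Thm 5, both AP-reductions PROVED in the tree), `X ↔ N ∧ Z` with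
`N := NPNotSubsetBPP`, `Z := N → X` and `¬S → Z`.
## §1 Audit lemmas (pure logic; restated from the sibling census of stmt-PneNP-2717)
## §2 Generic certificates: every "no FPRAS for a #P function" piece is ≥ N ≥ S; every
   "FPRAS(a) → FPRAS(g)" reduction piece with `g ≤_AP downsetCount` is a consequence of `¬S`.
## §3 The typed attempts D1–D13 with their assemblies and the violated clause.
-/

set_option linter.unusedVariables false
set_option linter.dupNamespace false

namespace Summit.PneNP.PneNP.Cruxes.IdealsNoFPRAS.DecompositionAudit

open _root_.Computability Polynomial
open Literature.Computability.Complexity Literature.Computability.Complexity.CodeFP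
  Literature.Computability.Complexity.Brick
open Summit.PneNP.PneNP (NPNotSubsetBPP NPNotSubsetBPP_iff)
open Summit.PneNP.PneNP.Theses.BISOrderDimension
open Summit.PneNP.PneNP.Theorems
open Summit.PneNP.PneNP.Theorems.NoFBPPApproxAboveUniqueness

/-! ## §0 Calibration -/

/-- `X` is literally `¬ HasFPRAS downsetCount`. [folklore] -/
theorem X_iff_not_hasFPRAS_downsetCount : IdealsNoFPRAS ↔ ¬ HasFPRAS downsetCount := Iff.rfl

/-- `X ⟹ S`, landed (`bisOrderDimension_assembly_proof`, stmt-PneNP-2098). [folklore] -/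
theorem X_implies_S : IdealsNoFPRAS → _root_.PneNP := bisOrderDimension_assembly_proof

/-- **The witness-length map is polynomial time**: `x ↦ 1^{m(x)}` with `m(x) = min(n_x, |x|)` if the entry
list of `x` has length `n_x²` and `m(x) = 0` otherwise. [cite: AroraBarakCC2009, §1.3] [folklore] -/
theorem witnessLength_codeFP :
    CodeFP strE unE fun x : List Bool =>
      if decide ((NegCNF.decList decodeNat (boolUnpair (sndF x)).1.length (boolUnpair (sndF x)).2).length =
          decodeNat (fstF x) * decodeNat (fstF x)) then min (decodeNat (fstF x)) x.length else 0 := by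
  have hfst : CodeFP strE strE fun w : List Bool => fstF w := CodeFP.of_fn fstF fstF_mem_FP fun _ => rfl
  have hsnd : CodeFP strE strE fun w : List Bool => sndF w := CodeFP.of_fn sndF sndF_mem_FP fun _ => rfl
  have hdec : CodeFP strE natE fun w : List Bool => decodeNat w :=
    CodeFP.of_fn canonF canonF_mem_FP canonF_eq_encodeNat_decodeNat
  have hlistC : CodeFP strE (listE natE) fun c : List Bool =>
      NegCNF.decList decodeNat (boolUnpair c).1.length (boolUnpair c).2 :=
    CodeFP.of_fn (CanonCode.canonListFnC 2 canonF) (CanonCode.canonListFnC_mem_FP 2 canonF_mem_FP) fun c =>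
      (bisOrderDimension_listDecode c).2.trans (congrFun (listE_eq encodingNatBool) _)
  have hn : CodeFP strE natE fun w : List Bool => decodeNat (fstF w) := (hdec.comp hfst :)
  have hL : CodeFP strE (rawE natE) fun w : List Bool =>
      NegCNF.decList decodeNat (boolUnpair (sndF w)).1.length (boolUnpair (sndF w)).2 :=
    ((rawOfList natE).comp (hlistC.comp hsnd) :)
  have hlenL := ((natLength natE).comp hL :)
  have hnn := (natMul.comp (hn.pair hn) :)
  have htest := (natEq.comp (hlenL.pair hnn) :)
  have hmin : CodeFP strE unE fun w : List Bool => min (decodeNat (fstF w)) w.length :=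
    (unOfNatMin.comp (strLength.pair hn) :)
  exact htest.ite hmin (CodeFP.const _ 0)

/-- **`#IDEALS ∈ #P`** (Valiant's class): `downsetCount x = #{y ∈ {0,1}^{m(x)} : ⟨x, y⟩ ∈ R}` for the
polynomial-time ideal-indicator relation `R` of `bisOrderDimension_exists_idealRel`, written as a uniform
exponential sum of the indicator of `R` (`sum_mem_SharpP`, `indicator_mem_SharpP`).
[cite: Valiant1979, §2] [cite: AroraBarak2009, Def. 17.2] -/
theorem downsetCount_mem_SharpP : downsetCount ∈ SharpP := by
  classical
  obtain ⟨R, hRP, hRiff⟩ := bisOrderDimension_exists_idealRel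
  obtain ⟨g, hg, hgspec⟩ := witnessLength_codeFP
  have hmem := ParityClosure.sum_mem_SharpP (ParityClosure.indicator_mem_SharpP hRP) hg
  convert hmem using 1
  funext x
  -- notation
  set n := decodeNat (fstF x) with hn
  set L := NegCNF.decList decodeNat (boolUnpair (sndF x)).1.length (boolUnpair (sndF x)).2 with hL
  set m := (if decide (L.length = n * n) then min n x.length else 0) with hm
  have hglen : (g x).length = m := by
    have := hgspec x
    rw [show strE x = x from rfl] at this
    rw [this, length_unE]
  -- the sum of indicators is the witness count
  have hsum : ∀ k : ℕ, (∑ z : List.Vector Bool k, (if boolPair x z.toList ∈ R then 1 else 0)) = countWitnesses R k x := by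
    intro k
    rw [Finset.sum_boole]
    unfold countWitnesses
    simp only [Nat.cast_id]
  have hkey : ∀ k : ℕ, k = m →
      (∑ z : List.Vector Bool k, (if boolPair x z.toList ∈ R then 1 else 0)) = downsetCount x := by
    rintro k rfl
    rw [hsum]
    -- the count identity, as in `bisOrderDimension_assembly_proof`
    have hLle : L.length ≤ x.length := by
      rw [hL, NegCNF.length_decList]
      have h1 := length_boolUnpair_parts_le (sndF x)
      have h2 := length_boolUnpair_parts_le x
      have h3 : (sndF x).length = (boolUnpair x).2.length := rfl
      omega
    by_cases hd : L.length = n * n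
    · have hnle : n ≤ x.length := by
        rcases Nat.eq_zero_or_pos n with h0 | hpos
        · rw [h0]; exact Nat.zero_le _
        · calc n ≤ n * n := Nat.le_mul_of_pos_left n hpos
            _ = L.length := hd.symm
            _ ≤ x.length := hLle
      have hmin : min n x.length = n := min_eq_left hnle
      have hmn : m = n := by rw [hm, decide_eq_true hd, if_pos rfl, hmin]
      rw [hmn, bisOrderDimension_countWitnesses_eq R hRiff x hd hmin]
      unfold downsetCount
      rw [bisOrderDimension_decode_some x hd]
      rfl
    · have hm0 : m = 0 := by rw [hm]; simp [hd]
      rw [hm0]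
      unfold downsetCount
      rw [bisOrderDimension_decode_none x hd]
      change _ = 0
      unfold countWitnesses
      refine Finset.card_eq_zero.2 (Finset.filter_eq_empty_iff.2 fun y _ h => hd ((hRiff x _).1 h).1)
  exact (hkey _ hglen).symm

/-- **`X ⟹ NP ⊄ BPP`**: no FPRAS for the `#P` function `#IDEALS` refutes `NP ⊆ BPP`, by the PhaseTwins
lever (`NP ⊆ BPP →` every `#P` function has an FPRAS; oracle-free Stockmeyer + JVV powering, PROVED).
So the crux is at least the conjecture node `NPNotSubsetBPP` (itself `≥ S`). [folklore] -/
theorem npNotSubsetBPP_of_X (hX : IdealsNoFPRAS) : NPNotSubsetBPP :=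
  fun hNB => hX (hasFPRAS_of_sharpP_of_NP_subset_BPP hNB downsetCount_mem_SharpP)

/-- `X ⟹ S` again, now factoring through the node (independent of the route's own assembly). [folklore] -/
theorem X_implies_S' : IdealsNoFPRAS → _root_.PneNP :=
  fun hX => pneNP_of_NPNotSubsetBPP_direct (npNotSubsetBPP_of_X hX)

/-- **DGGJ 2003, Theorem 5, in the tree: an FPRAS for #IDEALS gives one for #BIS** (`#BIS ≤_AP #DOWNSETS`,
`BISAPReducibleDownsets_holds`, PROVED) … [cite: DyerEtAl2003, Theorem 5] -/
theorem hasFPRAS_bisCount_of_downsetCount (h : HasFPRAS downsetCount) : HasFPRAS bisCount :=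
  HasFPRAS.of_apReducible DyerEtAl2003.BISAPReducibleDownsets_holds h

/-- … **and conversely** (`#DOWNSETS ≤_AP #BIS`, Lemma 9 / Theorem 5, `DownsetsAPReducibleBIS_holds`, PROVED).
[cite: DyerEtAl2003, Lemma 9] -/
theorem hasFPRAS_downsetCount_of_bisCount (h : HasFPRAS bisCount) : HasFPRAS downsetCount :=
  HasFPRAS.of_apReducible DyerEtAl2003.DownsetsAPReducibleBIS_holds h

/-- **`X ↔` "no FPRAS for #BIS"** — a landed `iff` (both AP-reductions are theorems of the tree): the
#BIS form of the crux is the SAME item, not a piece of it. [cite: DyerEtAl2003, Theorem 5] -/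
theorem X_iff_not_hasFPRAS_bisCount : IdealsNoFPRAS ↔ ¬ HasFPRAS bisCount :=
  ⟨fun h hb => h (hasFPRAS_downsetCount_of_bisCount hb), fun h hd => h (hasFPRAS_bisCount_of_downsetCount hd)⟩

/-- `S ↔ NP ⊄ P` in the prelude's classes (landed in the ConjectureNode file). [folklore] -/
theorem S_iff_not_NP_subset_P : _root_.PneNP ↔ ¬ (Nondeterministic.NP ⊆ Classes.P) :=
  pneNP_iff_not_NP_subset_P

/-- `¬S ⟹ NP ⊆ BPP` (`P ⊆ BPP`, proved). [folklore] -/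
theorem NP_subset_BPP_of_not_S (hS : ¬ _root_.PneNP) : Nondeterministic.NP ⊆ BPP := by
  have hNP : Nondeterministic.NP ⊆ Classes.P := by
    by_contra h
    exact hS (S_iff_not_NP_subset_P.2 h)
  exact fun L hL => P_subset_BPP_holds (hNP hL)

/-- `¬S ⟹ ¬X`: under `P = NP` every `#P` function has an FPRAS, in particular `#IDEALS`. [folklore] -/
theorem not_X_of_not_S (hS : ¬ _root_.PneNP) : ¬ IdealsNoFPRAS :=
  fun hX => npNotSubsetBPP_of_X hX (NP_subset_BPP_of_not_S hS)

/-- **The exact shape of the crux over the node: `X ↔ N ∧ Z`** with `N := NPNotSubsetBPP` and the bridge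
`Z := N → X` ("if `NP ⊄ BPP` then #IDEALS has no FPRAS", i.e. an FPRAS for #BIS would put `NP` in `BPP`:
NP-hardness of approximating #BIS under randomised reductions — OPEN, and contrary to the DGGJ conjecture
that #BIS is of intermediate approximation complexity). [folklore] -/
theorem X_iff_node_and_bridge : IdealsNoFPRAS ↔ (NPNotSubsetBPP ∧ (NPNotSubsetBPP → IdealsNoFPRAS)) :=
  ⟨fun hX => ⟨npNotSubsetBPP_of_X hX, fun _ => hX⟩, fun h => h.2 h.1⟩

/-- **The bridge `Z` is a consequence of `P = NP`** (vacuously: `¬S → NP ⊆ BPP → ¬N`). [folklore] -/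
theorem bridge_of_not_S (hS : ¬ _root_.PneNP) : NPNotSubsetBPP → IdealsNoFPRAS :=
  fun hN => absurd (NP_subset_BPP_of_not_S hS) hN


/-! ## §1 Audit lemmas (pure logic; the sibling census `NoFBPPApproxAboveUniqueness/DecompositionAudit` §1) -/

/-- **USELESS-PIECE LEMMA.** A piece implied by `¬S` carries none of `S`: delete it and the remaining
pieces of any assembly still prove `S`. [folklore] -/
theorem useless_piece {S A B : Prop} (hA : ¬ S → A) (h : A → B → S) : B → S :=
  fun hB => Classical.byContradiction fun hS => hS (h (hA hS) hB)

/-- **CONDITIONAL-PIECE LEMMA.** With `X → S` proved, a piece `A → X` whose antecedent follows from `¬S`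
is itself `≥ S` (kills every win–win along a dichotomy decided in the `P = NP` world). [folklore] -/
theorem conditional_piece {S X A : Prop} (hXS : X → S) (hA : ¬ S → A) : (A → X) → S :=
  fun h => Classical.byContradiction fun hS => hS (hXS (h (hA hS)))

/-- **BRIDGE LEMMA.** A piece with a PROVED arrow to `X` is `≥ S`. [folklore] -/
theorem bridge_piece {S X H : Prop} (hXS : X → S) (hb : H → X) : H → S :=
  fun h => hXS (hb h)

/-- **Pieces below `X` are `X ∨ E`.** [folklore] -/
theorem below_X_normal_form {X A : Prop} (h : X → A) : A ↔ (X ∨ (¬ X ∧ A)) := by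
  tauto

/-- **A conditional bridge from a hypothesis `H` is `X ∨ ¬H`.** [folklore] -/
theorem bridge_iff_or {X H : Prop} : (H → X) ↔ (X ∨ ¬ H) := by
  tauto

/-- **A piece that is a THEOREM makes its partner bridge `≡ X`.** [folklore] -/
theorem proved_piece_partner_iff {X A : Prop} (hA : A) : (A → X) ↔ X :=
  ⟨fun h => h hA, fun hX _ => hX⟩

/-! ## §2 Generic certificates -/

/-- **Every "no FPRAS for a `#P` function" piece is `≥ N`** (hence `≥ S`): the PhaseTwins lever,
contraposed. Covers the whole vocabulary of the #BIS programme once the counting function is checked to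
be in `#P` (#BIS, #DOWNSETS at any dimension, #1P1NSAT, bounded-degree #BIS, ferromagnetic Ising with
fields, Potts, stable matchings, …): such a piece violates clause (c) whatever its partner is. [folklore] -/
theorem noFPRAS_piece_ge_N {g : List Bool → ℕ} (hg : g ∈ SharpP) (h : ¬ HasFPRAS g) : NPNotSubsetBPP :=
  fun hNB => h (hasFPRAS_of_sharpP_of_NP_subset_BPP hNB hg)

/-- Same, down to the summit. [folklore] -/
theorem noFPRAS_piece_ge_S {g : List Bool → ℕ} (hg : g ∈ SharpP) (h : ¬ HasFPRAS g) : _root_.PneNP :=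
  pneNP_of_NPNotSubsetBPP_direct (noFPRAS_piece_ge_N hg h)

/-- **Restriction / "easier problem" pieces are `≥ X`**: if an FPRAS for #IDEALS yields one for `g`
(e.g. `g` = down-sets of `d`-dimensional orders, any sub-family recognisable in `P`, or any `g ≤_AP
#DOWNSETS`), then "no FPRAS for `g`" already gives `X` on its own — clause (c). [folklore] -/
theorem restriction_piece_ge_X {g : List Bool → ℕ} (hg : HasFPRAS downsetCount → HasFPRAS g)
    (h : ¬ HasFPRAS g) : IdealsNoFPRAS :=
  fun hd => h (hg hd)

/-- `AP`-reducibility form of the same. [cite: DyerEtAl2003, §1 (AP-reductions)] -/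
theorem apReducible_piece_ge_X {g : List Bool → ℕ} (hg : APReducible g downsetCount)
    (h : ¬ HasFPRAS g) : IdealsNoFPRAS :=
  restriction_piece_ge_X (fun hd => HasFPRAS.of_apReducible hg hd) h

/-- **Reduction-shaped pieces are consequences of `P = NP`.** Any implication whose consequent is an
FPRAS for a problem below #IDEALS (in particular for #BIS or for #IDEALS itself) HOLDS in the `P = NP`
world, because its consequent does; by `useless_piece` such a piece never carries `S`. [folklore] -/
theorem reduction_piece_of_not_S {a : Prop} {g : List Bool → ℕ} (hg : HasFPRAS downsetCount → HasFPRAS g)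
    (hS : ¬ _root_.PneNP) : a → HasFPRAS g :=
  fun _ => hg (Classical.byContradiction fun hd => not_X_of_not_S hS hd)

/-- **The route's own reduction items are all type (ii)**: under `P = NP` each of `DimThreeBISHard`,
`DimFourBISHard`, `IdealsReduceToBIS`, `DimSixtyFourBISHard` holds (their consequents are FPRASes for #BIS
or #IDEALS, which exist in that world by the lever and DGGJ Thm 5). They are honest OPEN REDUCTIONS —
strictly weaker than `S` — and exactly therefore cannot be pieces that carry `S`. [folklore] -/
theorem route_reductions_of_not_S (hS : ¬ _root_.PneNP) :
    DimThreeBISHard ∧ DimFourBISHard ∧ IdealsReduceToBIS ∧ DimSixtyFourBISHard := by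
  have hd : HasFPRAS downsetCount := Classical.byContradiction fun hd => not_X_of_not_S hS hd
  have hb : HasFPRAS bisCount := hasFPRAS_bisCount_of_downsetCount hd
  exact ⟨fun _ => hb, fun _ => hb, fun _ => hd, fun _ _ => hb⟩

/-! ## §3 The typed attempts -/

/-! ### D1 — restriction bridge `{T := DimThreeNoFPRAS (route crux #2), B := DimThreeToIdeals}` -/

/-- D1 assembly (modus ponens). [folklore] -/
theorem D1_assembly : DimThreeNoFPRAS → DimThreeToIdeals → IdealsNoFPRAS := fun hT hB => hB hT

/-- D1: the bridge is a THEOREM of the tree (stmt-PneNP-2095, `bisOrderDimension_dimThreeToIdeals_proof`) —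
not an open piece (clause (a)) … [folklore] -/
theorem D1_bridge_landed : DimThreeToIdeals := bisOrderDimension_dimThreeToIdeals_proof

/-- … so the other piece gives `X` ON ITS OWN by a landed arrow (clause (c); `bridge_piece`). [folklore] -/
theorem D1_piece_ge_X : DimThreeNoFPRAS → IdealsNoFPRAS := D1_bridge_landed

/-- D1: and `≥ N ≥ S`. [folklore] -/
theorem D1_piece_ge_N : DimThreeNoFPRAS → NPNotSubsetBPP := fun h => npNotSubsetBPP_of_X (D1_piece_ge_X h)

theorem D1_piece_ge_S : DimThreeNoFPRAS → _root_.PneNP := bridge_piece X_implies_S D1_piece_ge_X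

/-! ### D2 — equivalent problem `{T := ¬HasFPRAS bisCount ("no FPRAS for #BIS"), B := #BIS ≤_AP #IDEALS}` -/

/-- D2 assembly (modus tollens). [folklore] -/
theorem D2_assembly : ¬ HasFPRAS bisCount → (HasFPRAS downsetCount → HasFPRAS bisCount) → IdealsNoFPRAS :=
  fun hT hB hd => hT (hB hd)

/-- D2: the bridge is PROVED (DGGJ Thm 5 in the tree) — clause (a) … [cite: DyerEtAl2003, Theorem 5] -/
theorem D2_bridge_proved : HasFPRAS downsetCount → HasFPRAS bisCount := hasFPRAS_bisCount_of_downsetCount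

/-- … and the other piece is `X` up to a LANDED IFF — clause (c) verbatim. [cite: DyerEtAl2003, Theorem 5] -/
theorem D2_piece_iff_X : ¬ HasFPRAS bisCount ↔ IdealsNoFPRAS := X_iff_not_hasFPRAS_bisCount.symm

/-! ### D3 — NP-hardness bridge `{N := NPNotSubsetBPP, Z := N → X}` (the canonical form of every split) -/

/-- D3 assembly (modus ponens); with `X_iff_node_and_bridge` this split is EXACT. [folklore] -/
theorem D3_assembly : NPNotSubsetBPP → (NPNotSubsetBPP → IdealsNoFPRAS) → IdealsNoFPRAS := fun hN hZ => hZ hN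

/-- D3: piece `N` gives `S` on its own by a landed arrow (`P ⊆ BPP`) — clause (c). [folklore] -/
theorem D3_pieceN_ge_S : NPNotSubsetBPP → _root_.PneNP := pneNP_of_NPNotSubsetBPP_direct

/-- D3: piece `Z` ("approximating #BIS is NP-hard under randomised reductions") is a consequence of
`P = NP` — it carries none of `S` (`useless_piece`), and it is OPEN AGAINST the standing conjecture that
#BIS is of intermediate approximation complexity (clause (d): no line). [folklore] -/
theorem D3_pieceZ_of_not_S (hS : ¬ _root_.PneNP) : NPNotSubsetBPP → IdealsNoFPRAS := bridge_of_not_S hS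

/-- D3: whatever is joined to `Z`, the partner alone must prove `S`. [folklore] -/
theorem D3_partner_carries_S {B : Prop} (h : (NPNotSubsetBPP → IdealsNoFPRAS) → B → _root_.PneNP) :
    B → _root_.PneNP :=
  useless_piece (fun hS => bridge_of_not_S hS) h

/-! ### D4 — counting-class bridge `{H := PP ⊄ BPP, U := H → X}` ("approximating #BIS is PP-hard") -/

/-- D4 assembly (modus ponens; `trivial_seam`). [folklore] -/
theorem D4_assembly : ¬ (PP ⊆ BPP) → (¬ (PP ⊆ BPP) → IdealsNoFPRAS) → IdealsNoFPRAS := fun hH hU => hU hH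

/-- D4: `H` is a CONSEQUENCE of `X` (`X → N`, `NP ⊆ PP`), i.e. a weakest-unknown-consequence piece; it is
open under `P = NP` as well (type (iii)) and passes clause (c) honestly. [cite: Gill1977, Thm. 6.5] -/
theorem D4_H_of_X (hX : IdealsNoFPRAS) : ¬ (PP ⊆ BPP) :=
  fun hPB => npNotSubsetBPP_of_X hX fun L hL => hPB (NP_subset_PP_holds hL)

/-- D4: the bridge `U` is `X ∨ (PP ⊆ BPP)` — `X` with an inert escape hatch; its only conceivable plan is a
randomised polynomial-time Turing reduction from a `PP`-complete language to approximate #IDEALS, which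
composed with Stockmeyer's `FBPP^NP` approximate counter (`stockmeyerApproxCounting_holds`, proved for every
oracle) would put `PP`, hence `PH ⊆ P^PP` (Toda, `PH_subset_PSharpP` proved), inside `BPP^NP`: a collapse of
the polynomial hierarchy to its third level. Clause (d): no registrable line. [folklore] -/
theorem D4_bridge_iff : (¬ (PP ⊆ BPP) → IdealsNoFPRAS) ↔ (IdealsNoFPRAS ∨ (PP ⊆ BPP)) := by
  constructor
  · intro h
    by_cases hPB : PP ⊆ BPP
    · exact Or.inr hPB
    · exact Or.inl (h hPB)
  · rintro (hX | hPB) hH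
    · exact hX
    · exact absurd hPB hH

/-! ### D6 — win–win along the route's dial `{W₁ := DimThreeNoFPRAS → X, W₂ := ¬DimThreeNoFPRAS → X}` -/

/-- D6 assembly (proof by cases). [folklore] -/
theorem D6_assembly : (DimThreeNoFPRAS → IdealsNoFPRAS) → (¬ DimThreeNoFPRAS → IdealsNoFPRAS) → IdealsNoFPRAS :=
  fun h₁ h₂ => Classical.byCases h₁ h₂

/-- D6: `W₁` is LANDED (it is D1's bridge) — clause (a). [folklore] -/
theorem D6_W1_landed : DimThreeNoFPRAS → IdealsNoFPRAS := D1_piece_ge_X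

/-- D6: the dichotomy is DECIDED in the `P = NP` world — dimension 3 has an FPRAS there … [folklore] -/
theorem D6_not_dimThree_of_not_S (hS : ¬ _root_.PneNP) : ¬ DimThreeNoFPRAS :=
  fun hT => not_X_of_not_S hS (D1_piece_ge_X hT)

/-- … so `W₂` ("if dimension 3 is easy then #IDEALS is still hard") is `≥ S` ON ITS OWN — clause (c)
(`conditional_piece`). The same holds for the dial at every `d` and for every win–win along a dichotomy
that `P = NP` decides. [folklore] -/
theorem D6_W2_ge_S : (¬ DimThreeNoFPRAS → IdealsNoFPRAS) → _root_.PneNP :=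
  conditional_piece X_implies_S D6_not_dimThree_of_not_S

/-- D6: indeed `W₂ ↔ X` given the landed `W₁`. [folklore] -/
theorem D6_W2_iff_X : (¬ DimThreeNoFPRAS → IdealsNoFPRAS) ↔ IdealsNoFPRAS :=
  ⟨fun h => D6_assembly D6_W1_landed h, fun hX _ => hX⟩

/-! ### D10 — amplification split `{T := "no constant-factor approximator", boosting}` -/

/-- `HasConstFactorApprox N`: a polynomial-time randomised factor-`2` approximator (the FPRAS shape with the
accuracy slot frozen at `kη = 1`; DGGJ's RAS at the fixed tolerance `ε = log 2`). [cite: DyerEtAl2003, §1 (definition of RAS/FPRAS)] -/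
def HasConstFactorApprox (N : List Bool → ℕ) : Prop :=
  ∃ F ∈ FP, ∃ c : Polynomial ℕ, ∀ (x : List Bool) (kδ : ℕ), 0 < kδ →
    uniformProb (c.eval (x.length + 1 + kδ)) {u | ¬ IsApproxCount 1 (N x) (countEstimate F x 0 1 kδ u)} ≤ 1 / (kδ : ℝ)

/-- An FPRAS is in particular a factor-`2` approximator (`kη := 1`). [folklore] -/
theorem hasConstFactorApprox_of_hasFPRAS {N : List Bool → ℕ} (h : HasFPRAS N) : HasConstFactorApprox N := by
  obtain ⟨F, hF, c, hc⟩ := h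
  exact ⟨F, hF, c, fun x kδ hδ => hc x 1 kδ Nat.one_pos hδ⟩

/-- D10: the piece "no factor-2 approximator for #IDEALS" gives `X` ON ITS OWN (clause (c)); the
substantive theorem of the pair — Sinclair–Jerrum boosting for self-reducible problems — runs in the
direction `X → T`, which makes `T ≡ X`, never below it (Sinclair–Jerrum 1989; quoted as "boosting" by
DGGJ, Thm. 3). [cite: DyerEtAl2003, Theorem 3 (boosting)] -/
theorem D10_piece_ge_X (h : ¬ HasConstFactorApprox downsetCount) : IdealsNoFPRAS :=
  fun hd => h (hasConstFactorApprox_of_hasFPRAS hd)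

/-! ### D13 — the route's reductions as partners `{DimThreeBISHard ∨ DimFourBISHard ∨ …, T}` -/

/-- D13: joined to any of the route's reduction items, the partner `T` alone must prove `S`
(`useless_piece` with `route_reductions_of_not_S`). In the route as filed the partners are no-FPRAS
statements (`DimThreeNoFPRAS`, "no FPRAS for dim 4/64", "no FPRAS for #BIS"), each `≥ X` or `≥ N` by §2. [folklore] -/
theorem D13_partner_carries_S {B : Prop}
    (h : (DimThreeBISHard ∧ DimFourBISHard ∧ IdealsReduceToBIS ∧ DimSixtyFourBISHard) → B → _root_.PneNP) :
    B → _root_.PneNP :=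
  useless_piece route_reductions_of_not_S h

/-! ### Summary certificate -/

/-- **Every split of `X` is a split of the summit**: from any proved assembly `X₁ → X₂ → X` the two
pieces jointly prove `S`; after deleting the pieces that follow from `P = NP` (all reduction-shaped and
derandomisation-shaped ones), what remains proves `S` by itself. [folklore] -/
theorem summit_of_any_split {X₁ X₂ : Prop} (h : X₁ → X₂ → IdealsNoFPRAS) : X₁ → X₂ → _root_.PneNP :=
  fun h₁ h₂ => X_implies_S (h h₁ h₂)

end Summit.PneNP.PneNP.Cruxes.IdealsNoFPRAS.DecompositionAudit
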